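import Literature.ModelTheory.ExponentialFields.SemialgebraicCollarLenses
import Literature.ModelTheory.ExponentialFields.SemialgebraicFreeWindowCuts
import HarnessLib

/-!
# The rich cut lemma: capsule refinement subordinate to an open cover (Pawłucki's Prop. 2.5)

Topic `Literature/ModelTheory/ExponentialFields` — block B2 (assembly) of the proof of the
`C¹`-triangulation theorem for compact semialgebraic sets
(`Literature.ModelTheory.ExponentialFields.OhmotoShiota2017_c1Triangulation`, statement of
[OhmotoShiota2017, Thm. 1.1]) along the proof of [Pawlucki2024], specialized to `p = 1`.

**[Pawlucki2024, Prop. 2.5] in the laminar rich-cut form consumed by Lemma 5.1 (block B5).**  Let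
`[a, b]` be a capsule over a compact semialgebraic `D ⊆ ℝᵐ` (`a ≤ b` continuous semialgebraic) and
let finitely many open semialgebraic sets `V j ⊆ ℝᵐ⁺¹` cover its open fibres.  Then there is a
continuous semialgebraic laminar family `a = α'₀ ≤ α'₁ ≤ ⋯ ≤ α'_r = b` on `D` every nonempty open
piece `(α'_k x, α'_{k+1} x)` of which lies in a single `V j` (`exists_laminar_refinement`).
Proof: Part I (block B2b′: lens families), the free pieces (block B2c₂), Part II on every free window
(block B2c₃, after extending the window functions continuously to `ℝᵐ` by the semialgebraic Tietze
theorem), the assembly `rcValid_of_free`, and sorting (`exists_laminar_of_rcValid`, block B2a).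

No named facts are introduced (D-0026).

## References

* [Pawlucki2024] W. Pawłucki, *Strict `C^p`-triangulations — a new approach to
  desingularization*, J. Eur. Math. Soc. 26 (2024), 3863–3909, Prop. 2.5, Remark 2.2, Cor. 2.4.
* [OhmotoShiota2017] T. Ohmoto, M. Shiota, *`C¹`-triangulations of semialgebraic sets*,
  J. Topology 10 (2017), Thm. 1.1 (statement only).
-/

noncomputable section

open Set Filter
open _root_.Topology

namespace Literature.ModelTheory.ExponentialFields

open Literature.NumberTheory.Transcendental (IsSemialgebraicFunOn IsSemialgebraicMapOn
  isSemialgebraicFunOn_iff)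

section RCL

variable {m q : ℕ}

/-- Cut values depend only on the values of the window functions at the point. [cite: Pawlucki2024, Prop. 2.5] -/
theorem rcCutVals_congr {a b a' b' : (Fin m → ℝ) → ℝ} {𝒞 : Finset ((Fin m → ℝ) → ℝ)} {x : Fin m → ℝ}
    (ha : a x = a' x) (hb : b x = b' x) : rcCutVals a b 𝒞 x = rcCutVals a' b' 𝒞 x := by
  ext w; simp only [rcCutVals, mem_setOf_eq, ha, hb]

/-- Validity depends only on the values of the window functions at the point. [cite: Pawlucki2024, Prop. 2.5] -/
theorem rcValid_congr {a b a' b' : (Fin m → ℝ) → ℝ} {V : Fin q → Set (Fin (m + 1) → ℝ)}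
    {𝒞 : Finset ((Fin m → ℝ) → ℝ)} {x : Fin m → ℝ} (ha : a x = a' x) (hb : b x = b' x) :
    RCValid a b V 𝒞 x ↔ RCValid a' b' V 𝒞 x := by
  unfold RCValid
  rw [rcCutVals_congr ha hb, ha, hb]

open Classical in
/-- **The rich cut lemma** [Pawlucki2024, Prop. 2.5, rich-cut form]: finitely many continuous
semialgebraic cut functions on `ℝᵐ`, valid (`RCValid a b V`) at every point of `D`.
[cite: Pawlucki2024, Prop. 2.5] -/
theorem exists_rcValid {D : Set (Fin m → ℝ)} (hDc : IsCompact D) (hDs : IsSemialgebraic ℝ D)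
    {a b : (Fin m → ℝ) → ℝ} (ha : Continuous a) (hb : Continuous b)
    (has : IsSemialgebraicFunOn ℝ univ a) (hbs : IsSemialgebraicFunOn ℝ univ b) (hab : ∀ x ∈ D, a x ≤ b x)
    {V : Fin q → Set (Fin (m + 1) → ℝ)} (hVo : ∀ j, IsOpen (V j)) (hVs : ∀ j, IsSemialgebraic ℝ (V j))
    (hcov : ∀ x ∈ D, ∀ t ∈ Ioo (a x) (b x), ∃ j, (Fin.snoc x t : Fin (m + 1) → ℝ) ∈ V j) :
    ∃ 𝒞 : Finset ((Fin m → ℝ) → ℝ),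
      (∀ c ∈ 𝒞, Continuous c ∧ IsSemialgebraicFunOn ℝ univ c) ∧ ∀ x ∈ D, RCValid a b V 𝒞 x := by
  -- Part I: lens families
  obtain ⟨F, rfl, rfl, rfl, rfl, HF, SF⟩ := exists_lensFamilies hDc hDs ha hb has hbs hab hVo hVs hcov
  -- global continuous semialgebraic extensions of the laminar functions `α k`
  have hext : ∀ k, ∃ G : (Fin m → ℝ) → ℝ, Continuous G ∧ IsSemialgebraicFunOn ℝ univ G ∧ EqOn G (F.α k) F.D :=
    fun k => exists_continuous_semialgebraic_extension hDc hDs (LensFamilies.α_sa SF k) (LensFamilies.continuousOn_α HF k)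
  choose G hGc hGs hGeq using hext
  -- Part II on every free window
  have hwin : ∀ k, ∃ 𝒞 : Finset ((Fin m → ℝ) → ℝ), (∀ c ∈ 𝒞, Continuous c ∧ IsSemialgebraicFunOn ℝ univ c) ∧
      ∀ x ∈ F.Free k, RCValid (F.α k) (F.α (k + 1)) F.V 𝒞 x := by
    intro k
    set Wk : FreeWindow m q := ⟨F.V, G k, G (k + 1), F.Free k⟩ with hWk
    have HW : Wk.Hyp :=
      { isOpen_V := hVo
        V_sa := hVs
        γ_cont := hGc k
        δ_cont := hGc (k + 1)
        γ_sa := hGs k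
        δ_sa := hGs (k + 1)
        Fr_sa := LensFamilies.free_sa SF k
        Fr_bdd := hDc.isBounded.subset (LensFamilies.free_subset k)
        γ_lt_δ := fun x hx => by
          show G k x < G (k + 1) x
          rw [hGeq k hx.1, hGeq (k + 1) hx.1]; exact hx.2.1
        pinch := fun z hz hnz => by
          have hzD : z ∈ F.D := closure_minimal (LensFamilies.free_subset k) hDc.isClosed hz
          show G k z = G (k + 1) z
          rw [hGeq k hzD, hGeq (k + 1) hzD]
          exact LensFamilies.α_eq_of_mem_closure_free HF hz hnz
        cover := fun x hx t ht => by
          have hxD : x ∈ F.D := hx.1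
          have ht' : t ∈ Icc (F.α k x) (F.α (k + 1) x) := by
            have h1 : G k x = F.α k x := hGeq k hxD
            have h2 : G (k + 1) x = F.α (k + 1) x := hGeq (k + 1) hxD
            exact ⟨h1 ▸ ht.1, h2 ▸ ht.2⟩
          exact LensFamilies.exists_mem_V_of_free HF hx ht' }
    obtain ⟨𝒞, h𝒞, hval⟩ := FreeWindow.exists_rcValid_free HW
    refine ⟨𝒞, h𝒞, fun x hx => ?_⟩
    have h := hval x hx
    exact (rcValid_congr (hGeq k hx.1) (hGeq (k + 1) hx.1)).1 h
  choose 𝒞k h𝒞k hvalk using hwin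
  -- assembly
  refine ⟨Finset.univ.image F.cuts ∪ (Finset.range (F.N + 1)).biUnion 𝒞k, fun c hc => ?_, fun x hx => ?_⟩
  · rcases Finset.mem_union.1 hc with hc | hc
    · obtain ⟨j, -, rfl⟩ := Finset.mem_image.1 hc
      have hcont : Continuous (F.cuts j) := by
        refine Fin.addCases (fun i => ?_) (fun i => ?_) j
        · refine Fin.addCases (fun i => ?_) (fun i => ?_) i
          · simp only [LensFamilies.cuts, Fin.append_left]; exact HF.bm_cont i
          · simp only [LensFamilies.cuts, Fin.append_left, Fin.append_right]; exact HF.bp_cont i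
        · refine Fin.addCases (fun i => ?_) (fun i => ?_) i
          · simp only [LensFamilies.cuts, Fin.append_right, Fin.append_left]; exact HF.tm_cont i
          · simp only [LensFamilies.cuts, Fin.append_right]; exact HF.tp_cont i
      exact ⟨hcont, LensFamilies.cuts_sa SF j⟩
    · obtain ⟨k, -, hck⟩ := Finset.mem_biUnion.1 hc
      exact h𝒞k k c hck
  · refine LensFamilies.rcValid_of_free HF _ (fun j => Finset.mem_union_left _ (Finset.mem_image.2 ⟨j, Finset.mem_univ _, rfl⟩))
      (fun k hk x hxk => (hvalk k x hxk).mono ?_) hx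
    exact Finset.subset_union_right.trans' (Finset.subset_biUnion_of_mem 𝒞k (Finset.mem_range.2 (Nat.lt_succ_of_le hk)))

open Classical in
/-- **[Pawlucki2024, Prop. 2.5] (with Remark 2.2 / Cor. 2.4), laminar form**: a capsule over a compact
semialgebraic base whose open fibres are covered by finitely many open semialgebraic sets admits a
continuous semialgebraic laminar refinement `a = α'₀ ≤ ⋯ ≤ α'_r = b` every nonempty open piece of
which lies, fibrewise, in a single member of the cover. [cite: Pawlucki2024, Prop. 2.5] -/
theorem exists_laminar_refinement {D : Set (Fin m → ℝ)} (hDc : IsCompact D) (hDs : IsSemialgebraic ℝ D)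
    {a b : (Fin m → ℝ) → ℝ} (ha : Continuous a) (hb : Continuous b)
    (has : IsSemialgebraicFunOn ℝ univ a) (hbs : IsSemialgebraicFunOn ℝ univ b) (hab : ∀ x ∈ D, a x ≤ b x)
    {V : Fin q → Set (Fin (m + 1) → ℝ)} (hVo : ∀ j, IsOpen (V j)) (hVs : ∀ j, IsSemialgebraic ℝ (V j))
    (hcov : ∀ x ∈ D, ∀ t ∈ Ioo (a x) (b x), ∃ j, (Fin.snoc x t : Fin (m + 1) → ℝ) ∈ V j) :
    ∃ (r : ℕ) (α : ℕ → (Fin m → ℝ) → ℝ),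
      (∀ k, ContinuousOn (α k) D) ∧ (∀ k, IsSemialgebraicFunOn ℝ D (α k)) ∧
      (∀ x ∈ D, Monotone fun k => α k x) ∧ (∀ x ∈ D, α 0 x = a x) ∧ (∀ x ∈ D, ∀ k, r ≤ k → α k x = b x) ∧
      ∀ x ∈ D, ∀ k < r, α k x < α (k + 1) x → RCGood V x (α k x) (α (k + 1) x) := by
  obtain ⟨𝒞, h𝒞, hval⟩ := exists_rcValid hDc hDs ha hb has hbs hab hVo hVs hcov
  -- enumerate the cut family
  set e := 𝒞.equivFin with he
  set c : Fin 𝒞.card → (Fin m → ℝ) → ℝ := fun i => (e.symm i).1 with hc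
  have himg : Finset.univ.image c = 𝒞 := by
    ext f
    constructor
    · intro hf
      obtain ⟨i, -, rfl⟩ := Finset.mem_image.1 hf
      exact (e.symm i).2
    · intro hf
      exact Finset.mem_image.2 ⟨e ⟨f, hf⟩, Finset.mem_univ _, by simp [hc]⟩
  have hcc : ∀ i, ContinuousOn (c i) D := fun i => (h𝒞 _ (e.symm i).2).1.continuousOn
  have hcs : ∀ i, IsSemialgebraicFunOn ℝ D (c i) := fun i => (h𝒞 _ (e.symm i).2).2.mono (subset_univ _) hDs
  refine exists_laminar_of_rcValid hDs ha.continuousOn hb.continuousOn (has.mono (subset_univ _) hDs)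
    (hbs.mono (subset_univ _) hDs) hab hcc hcs fun x hx => ?_
  rw [himg]; exact hval x hx

end RCL

end Literature.ModelTheory.ExponentialFields
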